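import Literature.NumberTheory.Automorphic.SelfDualStableLatticeDepthCountCM      -- ★ A-p13 FILE 4: cumulative level counts at `w`, finiteness, inert package, `_of_frame` lemmas
import HarnessLib

/-!
# EXACT-DEPTH COUNTS AT THE CM PLACE `w` (road «R1LL-tree», (α) LAYER 2-A, second half): the number of `γ`-fixed self-dual ∕ ϖ-modular vertices of the tree of
# `U(Φ₂)_v` at depth EXACTLY `i`: `[i ≤ N ∧ N − i ≡ e]·w(q_v, N − i)` (Flicker 1998 §6 p. 95; Kottwitz 1988 §2)

Topic `NumberTheory/Automorphic`; namespaces `Literature.NumberTheory.Automorphic` (§0, generic) and `….UnitaryGroup` (§1, at `w`).  THEOREMS ONLY (no definition,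
no instance, no notation, no named fact, no `sorry`).  Cell `pub/hodgecm-mathlib`, F0∕P3a road «R1LL-tree» (architect A-p16 (g27) RULINGS A-8 (c), A-10 (a), A-13 (a)),
hand A-p13 (g31); fifth file of the I-2 «depth counts» brick, companion of ★ `SelfDualStableLatticeDepthCountCM` (FILE 4).  HC_CM is proved only modulo the printed
citations until rung 0 closes; nothing printed is a letter here.

* §0 (generic `F`, frame `Q` with `ᵗσ(Q)JQ = ϖ^e • 1` resp. `ᵗσ(Q)(ϖ⁻¹J)Q = ϖ^e • 1`, `Q⁻¹γQ = diag(a, c)`): `ncard_selfDualStable_level_eq_sum_of_frame`,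
  **`ncard_selfDualStable_depth_eq_ite_of_frame`**, **`ncard_modularStable_depth_eq_ite_of_frame`** — exact depth by SUBTRACTION of two cumulative counts
  (finiteness ★ FILES 2–4, monotonicity + bookkeeping ★ FILE 2); all rewriting happens here, over field-sized terms.
* §1 (at `w`, SETTING of ★ FILE 4: `γ ∈ U(σ_w, (Φ₂)_w)`, eigenframe `γ P = P · diag(u)`, `u₀ ≠ u₁` of norm one, `|u₀ − u₁|_w = |ϖ_w^N|`, `q_v = |𝓞_{L⁺} ∕ v|`):
  **`exists_ncard_selfDualStable_antidiagTwo_depth_eq_ite_at`** (`∃ e ≤ 1, (Even (log |⟨p₀,p₀⟩|) ↔ e = 0) ∧ #{Λ ∈ S((Φ₂)_w, γ) | depth exactly i at u₁} =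
  [i ≤ N ∧ (N − i) % 2 = e]·w(q_v, N − i)`) and **`exists_ncard_modularStable_antidiagTwo_depth_eq_ite_at`** (`↔ e = 1`) — the `#{depth = i}` terms of the (α)
  depth expansion ★ p843062 at the two vertex types, by `exact` of §0 at the ★ (L5-d1) frame.

## References
* [Flicker1998UnitaryFL] Y. Z. Flicker, *Elementary proof of the fundamental lemma for a unitary group*, Canad. J. Math. 50 (1998), §6 p. 95 + REMARK.
* [Kottwitz1988] R. E. Kottwitz, *Tamagawa numbers*, Ann. of Math. 127 (1988), §2.
* [Rogawski1990] J. D. Rogawski, *Automorphic Representations of Unitary Groups in Three Variables* (1990), §4.9 Lemma 4.9.3 p. 56.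
-/

set_option autoImplicit false

noncomputable section

open NumberField IsDedekindDomain Matrix Finset ValuativeRel
open scoped ValuativeRel Matrix MatrixGroups

namespace Literature.NumberTheory.Automorphic

/-! ## §0 Generic frame lemmas: the counts of `S(J, γ)` ∕ `M(J, γ)` read through a rescaled eigenframe `Q` (`ᵗσ(Q)JQ = ϖ^e • 1`, `Q⁻¹γQ = diag(a,c)`) -/

section OfFrame

variable {F : Type*} [Field F] [ValuativeRel F] (σ : F →+* F) {ϖ : F} (hϖ : IsUniformizingElement ϖ)
  (σO : 𝒪[F] →+* 𝒪[F]) (hσO' : ∀ x : 𝒪[F], ((σO x : 𝒪[F]) : F) = σ x) (hσσ : ∀ x, σO (σO x) = x)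
  (hσϖ : σ ϖ = ϖ) {e : ℕ} (he : e ≤ 1) {a c : F} {N : ℕ} (J : Matrix (Fin 2) (Fin 2) F) (γ Q : GL (Fin 2) F)
  (hQγ : ((Q⁻¹ * γ * Q : GL (Fin 2) F) : Matrix (Fin 2) (Fin 2) F) = !![a, 0; 0, c])
  (ha : valuation F a = 1) (hc : valuation F c = 1) (hN : valuation F (a - c) = valuation F (ϖ ^ N))

include hϖ hσO' hσσ hσϖ he hQγ ha hc hN in
/-- **The self-dual level count through a frame**: `ᵗσ(Q)JQ = ϖ^e • 1`, `Q⁻¹γQ = diag(a, c)` ⇒ `#{Λ ∈ S(J, γ) | (γ − c·1)Λ ≤ ϖ^iΛ} = Σ_{j ≤ N, j ≡ e, j + i ≤ N} w(j)`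
(★ FILE 2 transport + ★ FILE 1 count). [cite: Kottwitz1988, §2] [cite: Flicker1998UnitaryFL, §6 p. 95] -/
theorem ncard_selfDualStable_level_eq_sum_of_frame [IsDiscreteValuationRing 𝒪[F]] [Finite (IsLocalRing.ResidueField 𝒪[F])]
    [IsAdicComplete (IsLocalRing.maximalIdeal 𝒪[F]) 𝒪[F]] {a₀ : 𝒪[F]} (ha₀ : IsUnit (σO a₀ - a₀)) {q : ℕ}
    (hq : Nat.card (IsLocalRing.ResidueField 𝒪[F]) = q ^ 2)
    (hform : formCongr σ Q J = (ϖ ^ (e : ℤ)) • (1 : Matrix (Fin 2) (Fin 2) F)) (i : ℕ) :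
    {Λ : Submodule 𝒪[F] (Fin 2 → F) |
        ((∃ g : GL (Fin 2) F, (∃ J' ∈ glInt 2 F, (J' : Matrix (Fin 2) (Fin 2) F) = formCongr σ g J) ∧
            Λ = Submodule.span 𝒪[F] (Set.range ((g : Matrix (Fin 2) (Fin 2) F))ᵀ)) ∧
          Λ.map ((Matrix.toLin' ((γ : GL (Fin 2) F) : Matrix (Fin 2) (Fin 2) F)).restrictScalars 𝒪[F]) = Λ) ∧
        Λ.map ((Matrix.toLin' (((γ : GL (Fin 2) F) : Matrix (Fin 2) (Fin 2) F) - c • (1 : Matrix (Fin 2) (Fin 2) F))).restrictScalars 𝒪[F]) ≤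
          Λ.map ((Matrix.toLin' (ϖ ^ i • (1 : Matrix (Fin 2) (Fin 2) F))).restrictScalars 𝒪[F])}.ncard =
      ∑ j ∈ (range (N + 1)).filter (fun j => j % 2 = e ∧ j + i ≤ N), (if j = 0 then 1 else q ^ (j - 1) * (q + 1)) := by
  rw [ncard_selfDualStable_level_congr σ J γ Q c (ϖ ^ i), hform]
  exact ncard_selfDualStable_smul_one_diag_level_self_eq_sum hϖ σO hσO' hσσ hσϖ he _ hQγ ha hc hN ha₀ hq i

include hϖ hσO' hσσ hσϖ he hQγ ha hc hN in
/-- **The self-dual EXACT-DEPTH count through a frame**: `#{Λ ∈ S(J, γ) | depth exactly i at c} = [i ≤ N ∧ (N − i) % 2 = e]·w(N − i)` (subtraction: two cumulative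
counts, finiteness ★ FILE 3∕FILE 2, monotonicity and bookkeeping ★ FILE 2). [cite: Kottwitz1988, §2] [cite: Flicker1998UnitaryFL, §6 p. 95 REMARK] -/
theorem ncard_selfDualStable_depth_eq_ite_of_frame [IsDiscreteValuationRing 𝒪[F]] [Finite (IsLocalRing.ResidueField 𝒪[F])]
    [IsAdicComplete (IsLocalRing.maximalIdeal 𝒪[F]) 𝒪[F]] {a₀ : 𝒪[F]} (ha₀ : IsUnit (σO a₀ - a₀)) {q : ℕ}
    (hq : Nat.card (IsLocalRing.ResidueField 𝒪[F]) = q ^ 2)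
    (hform : formCongr σ Q J = (ϖ ^ (e : ℤ)) • (1 : Matrix (Fin 2) (Fin 2) F)) (i : ℕ) :
    {Λ : Submodule 𝒪[F] (Fin 2 → F) |
        ((∃ g : GL (Fin 2) F, (∃ J' ∈ glInt 2 F, (J' : Matrix (Fin 2) (Fin 2) F) = formCongr σ g J) ∧
            Λ = Submodule.span 𝒪[F] (Set.range ((g : Matrix (Fin 2) (Fin 2) F))ᵀ)) ∧
          Λ.map ((Matrix.toLin' ((γ : GL (Fin 2) F) : Matrix (Fin 2) (Fin 2) F)).restrictScalars 𝒪[F]) = Λ) ∧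
        (Λ.map ((Matrix.toLin' (((γ : GL (Fin 2) F) : Matrix (Fin 2) (Fin 2) F) - c • (1 : Matrix (Fin 2) (Fin 2) F))).restrictScalars 𝒪[F]) ≤
          Λ.map ((Matrix.toLin' (ϖ ^ i • (1 : Matrix (Fin 2) (Fin 2) F))).restrictScalars 𝒪[F]) ∧
        ¬ Λ.map ((Matrix.toLin' (((γ : GL (Fin 2) F) : Matrix (Fin 2) (Fin 2) F) - c • (1 : Matrix (Fin 2) (Fin 2) F))).restrictScalars 𝒪[F]) ≤
          Λ.map ((Matrix.toLin' (ϖ ^ (i + 1) • (1 : Matrix (Fin 2) (Fin 2) F))).restrictScalars 𝒪[F]))}.ncard =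
      if i ≤ N ∧ (N - i) % 2 = e then (if N - i = 0 then 1 else q ^ (N - i - 1) * (q + 1)) else 0 := by
  have hi := ncard_selfDualStable_level_eq_sum_of_frame σ hϖ σO hσO' hσσ hσϖ he J γ Q hQγ ha hc hN ha₀ hq hform i
  have hi1 := ncard_selfDualStable_level_eq_sum_of_frame σ hϖ σO hσO' hσσ hσϖ he J γ Q hQγ ha hc hN ha₀ hq hform (i + 1)
  rw [sum_filter_mod_two_add_le_eq _ N e i] at hi
  have hfin := (finite_selfDualStable_of_congr σ J γ Q (hform ▸ finite_selfDualStable_smul_one_diag σ hϖ σO hσO' hσσ hσϖ he _ hQγ ha hc hN ha₀ hq))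
  set Si := {Λ : Submodule 𝒪[F] (Fin 2 → F) |
        ((∃ g : GL (Fin 2) F, (∃ J' ∈ glInt 2 F, (J' : Matrix (Fin 2) (Fin 2) F) = formCongr σ g J) ∧
            Λ = Submodule.span 𝒪[F] (Set.range ((g : Matrix (Fin 2) (Fin 2) F))ᵀ)) ∧
          Λ.map ((Matrix.toLin' ((γ : GL (Fin 2) F) : Matrix (Fin 2) (Fin 2) F)).restrictScalars 𝒪[F]) = Λ) ∧
        Λ.map ((Matrix.toLin' (((γ : GL (Fin 2) F) : Matrix (Fin 2) (Fin 2) F) - c • (1 : Matrix (Fin 2) (Fin 2) F))).restrictScalars 𝒪[F]) ≤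
          Λ.map ((Matrix.toLin' (ϖ ^ i • (1 : Matrix (Fin 2) (Fin 2) F))).restrictScalars 𝒪[F])} with hSi
  set Si1 := {Λ : Submodule 𝒪[F] (Fin 2 → F) |
        ((∃ g : GL (Fin 2) F, (∃ J' ∈ glInt 2 F, (J' : Matrix (Fin 2) (Fin 2) F) = formCongr σ g J) ∧
            Λ = Submodule.span 𝒪[F] (Set.range ((g : Matrix (Fin 2) (Fin 2) F))ᵀ)) ∧
          Λ.map ((Matrix.toLin' ((γ : GL (Fin 2) F) : Matrix (Fin 2) (Fin 2) F)).restrictScalars 𝒪[F]) = Λ) ∧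
        Λ.map ((Matrix.toLin' (((γ : GL (Fin 2) F) : Matrix (Fin 2) (Fin 2) F) - c • (1 : Matrix (Fin 2) (Fin 2) F))).restrictScalars 𝒪[F]) ≤
          Λ.map ((Matrix.toLin' (ϖ ^ (i + 1) • (1 : Matrix (Fin 2) (Fin 2) F))).restrictScalars 𝒪[F])} with hSi1
  have hsub : Si1 ⊆ Si := fun Λ hΛ => ⟨hΛ.1, map_le_map_pow_smul_one_of_succ hϖ.mem i _ Λ hΛ.2⟩
  have hsplit := Set.ncard_sdiff_add_ncard_of_subset hsub (hfin.subset fun Λ hΛ => hΛ.1)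
  rw [hi, hi1] at hsplit
  have hdiff : {Λ : Submodule 𝒪[F] (Fin 2 → F) |
        ((∃ g : GL (Fin 2) F, (∃ J' ∈ glInt 2 F, (J' : Matrix (Fin 2) (Fin 2) F) = formCongr σ g J) ∧
            Λ = Submodule.span 𝒪[F] (Set.range ((g : Matrix (Fin 2) (Fin 2) F))ᵀ)) ∧
          Λ.map ((Matrix.toLin' ((γ : GL (Fin 2) F) : Matrix (Fin 2) (Fin 2) F)).restrictScalars 𝒪[F]) = Λ) ∧
        (Λ.map ((Matrix.toLin' (((γ : GL (Fin 2) F) : Matrix (Fin 2) (Fin 2) F) - c • (1 : Matrix (Fin 2) (Fin 2) F))).restrictScalars 𝒪[F]) ≤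
          Λ.map ((Matrix.toLin' (ϖ ^ i • (1 : Matrix (Fin 2) (Fin 2) F))).restrictScalars 𝒪[F]) ∧
        ¬ Λ.map ((Matrix.toLin' (((γ : GL (Fin 2) F) : Matrix (Fin 2) (Fin 2) F) - c • (1 : Matrix (Fin 2) (Fin 2) F))).restrictScalars 𝒪[F]) ≤
          Λ.map ((Matrix.toLin' (ϖ ^ (i + 1) • (1 : Matrix (Fin 2) (Fin 2) F))).restrictScalars 𝒪[F]))} = Si \ Si1 := by
    ext Λ
    simp only [hSi, hSi1, Set.mem_setOf_eq, Set.mem_sdiff, not_and]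
    exact ⟨fun h => ⟨⟨h.1, h.2.1⟩, fun _ => h.2.2⟩, fun h => ⟨h.1.1, h.1.2, h.2 h.1.1⟩⟩
  rw [hdiff]
  omega

include hϖ hσO' hσσ hσϖ he hQγ ha hc hN in
/-- **The ϖ-modular EXACT-DEPTH count through a frame** (`ᵗσ(Q)(ϖ⁻¹J)Q = ϖ^e • 1`): `#{Λ ∈ M(J, γ) | depth exactly i at c} = [i ≤ N ∧ (N − i) % 2 = e]·w(N − i)`
(★ FILE 4 `ncard_modularStable_level_eq_sum_of_frame`, `finite_modularStable_of_frame`). [cite: Kottwitz1988, §2] [cite: Flicker1998UnitaryFL, §6 p. 95 REMARK] -/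
theorem ncard_modularStable_depth_eq_ite_of_frame [IsDiscreteValuationRing 𝒪[F]] [Finite (IsLocalRing.ResidueField 𝒪[F])]
    [IsAdicComplete (IsLocalRing.maximalIdeal 𝒪[F]) 𝒪[F]] {a₀ : 𝒪[F]} (ha₀ : IsUnit (σO a₀ - a₀)) {q : ℕ}
    (hq : Nat.card (IsLocalRing.ResidueField 𝒪[F]) = q ^ 2)
    (hform : formCongr σ Q (ϖ⁻¹ • J) = (ϖ ^ (e : ℤ)) • (1 : Matrix (Fin 2) (Fin 2) F)) (i : ℕ) :
    {Λ : Submodule 𝒪[F] (Fin 2 → F) |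
        ((∃ g : GL (Fin 2) F, (∃ J' ∈ glInt 2 F, ϖ • (J' : Matrix (Fin 2) (Fin 2) F) = formCongr σ g J) ∧
            Λ = Submodule.span 𝒪[F] (Set.range ((g : Matrix (Fin 2) (Fin 2) F))ᵀ)) ∧
          Λ.map ((Matrix.toLin' ((γ : GL (Fin 2) F) : Matrix (Fin 2) (Fin 2) F)).restrictScalars 𝒪[F]) = Λ) ∧
        (Λ.map ((Matrix.toLin' (((γ : GL (Fin 2) F) : Matrix (Fin 2) (Fin 2) F) - c • (1 : Matrix (Fin 2) (Fin 2) F))).restrictScalars 𝒪[F]) ≤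
          Λ.map ((Matrix.toLin' (ϖ ^ i • (1 : Matrix (Fin 2) (Fin 2) F))).restrictScalars 𝒪[F]) ∧
        ¬ Λ.map ((Matrix.toLin' (((γ : GL (Fin 2) F) : Matrix (Fin 2) (Fin 2) F) - c • (1 : Matrix (Fin 2) (Fin 2) F))).restrictScalars 𝒪[F]) ≤
          Λ.map ((Matrix.toLin' (ϖ ^ (i + 1) • (1 : Matrix (Fin 2) (Fin 2) F))).restrictScalars 𝒪[F]))}.ncard =
      if i ≤ N ∧ (N - i) % 2 = e then (if N - i = 0 then 1 else q ^ (N - i - 1) * (q + 1)) else 0 := by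
  have hi := ncard_modularStable_level_eq_sum_of_frame σ hϖ σO hσO' hσσ hσϖ he J γ Q hQγ ha hc hN ha₀ hq hform i
  have hi1 := ncard_modularStable_level_eq_sum_of_frame σ hϖ σO hσO' hσσ hσϖ he J γ Q hQγ ha hc hN ha₀ hq hform (i + 1)
  rw [sum_filter_mod_two_add_le_eq _ N e i] at hi
  have hfin := (finite_modularStable_of_frame σ hϖ σO hσO' hσσ hσϖ he J γ Q hQγ ha hc hN ha₀ hq hform)
  set Si := {Λ : Submodule 𝒪[F] (Fin 2 → F) |
        ((∃ g : GL (Fin 2) F, (∃ J' ∈ glInt 2 F, ϖ • (J' : Matrix (Fin 2) (Fin 2) F) = formCongr σ g J) ∧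
            Λ = Submodule.span 𝒪[F] (Set.range ((g : Matrix (Fin 2) (Fin 2) F))ᵀ)) ∧
          Λ.map ((Matrix.toLin' ((γ : GL (Fin 2) F) : Matrix (Fin 2) (Fin 2) F)).restrictScalars 𝒪[F]) = Λ) ∧
        Λ.map ((Matrix.toLin' (((γ : GL (Fin 2) F) : Matrix (Fin 2) (Fin 2) F) - c • (1 : Matrix (Fin 2) (Fin 2) F))).restrictScalars 𝒪[F]) ≤
          Λ.map ((Matrix.toLin' (ϖ ^ i • (1 : Matrix (Fin 2) (Fin 2) F))).restrictScalars 𝒪[F])} with hSi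
  set Si1 := {Λ : Submodule 𝒪[F] (Fin 2 → F) |
        ((∃ g : GL (Fin 2) F, (∃ J' ∈ glInt 2 F, ϖ • (J' : Matrix (Fin 2) (Fin 2) F) = formCongr σ g J) ∧
            Λ = Submodule.span 𝒪[F] (Set.range ((g : Matrix (Fin 2) (Fin 2) F))ᵀ)) ∧
          Λ.map ((Matrix.toLin' ((γ : GL (Fin 2) F) : Matrix (Fin 2) (Fin 2) F)).restrictScalars 𝒪[F]) = Λ) ∧
        Λ.map ((Matrix.toLin' (((γ : GL (Fin 2) F) : Matrix (Fin 2) (Fin 2) F) - c • (1 : Matrix (Fin 2) (Fin 2) F))).restrictScalars 𝒪[F]) ≤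
          Λ.map ((Matrix.toLin' (ϖ ^ (i + 1) • (1 : Matrix (Fin 2) (Fin 2) F))).restrictScalars 𝒪[F])} with hSi1
  have hsub : Si1 ⊆ Si := fun Λ hΛ => ⟨hΛ.1, map_le_map_pow_smul_one_of_succ hϖ.mem i _ Λ hΛ.2⟩
  have hsplit := Set.ncard_sdiff_add_ncard_of_subset hsub (hfin.subset fun Λ hΛ => hΛ.1)
  rw [hi, hi1] at hsplit
  have hdiff : {Λ : Submodule 𝒪[F] (Fin 2 → F) |
        ((∃ g : GL (Fin 2) F, (∃ J' ∈ glInt 2 F, ϖ • (J' : Matrix (Fin 2) (Fin 2) F) = formCongr σ g J) ∧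
            Λ = Submodule.span 𝒪[F] (Set.range ((g : Matrix (Fin 2) (Fin 2) F))ᵀ)) ∧
          Λ.map ((Matrix.toLin' ((γ : GL (Fin 2) F) : Matrix (Fin 2) (Fin 2) F)).restrictScalars 𝒪[F]) = Λ) ∧
        (Λ.map ((Matrix.toLin' (((γ : GL (Fin 2) F) : Matrix (Fin 2) (Fin 2) F) - c • (1 : Matrix (Fin 2) (Fin 2) F))).restrictScalars 𝒪[F]) ≤
          Λ.map ((Matrix.toLin' (ϖ ^ i • (1 : Matrix (Fin 2) (Fin 2) F))).restrictScalars 𝒪[F]) ∧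
        ¬ Λ.map ((Matrix.toLin' (((γ : GL (Fin 2) F) : Matrix (Fin 2) (Fin 2) F) - c • (1 : Matrix (Fin 2) (Fin 2) F))).restrictScalars 𝒪[F]) ≤
          Λ.map ((Matrix.toLin' (ϖ ^ (i + 1) • (1 : Matrix (Fin 2) (Fin 2) F))).restrictScalars 𝒪[F]))} = Si \ Si1 := by
    ext Λ
    simp only [hSi, hSi1, Set.mem_setOf_eq, Set.mem_sdiff, not_and]
    exact ⟨fun h => ⟨⟨h.1, h.2.1⟩, fun _ => h.2.2⟩, fun h => ⟨h.1.1, h.1.2, h.2 h.1.1⟩⟩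
  rw [hdiff]
  omega

end OfFrame

end Literature.NumberTheory.Automorphic

namespace Literature.NumberTheory.Automorphic.UnitaryGroup

open Literature.NumberTheory.Rogawski1990 Literature.NumberTheory.GaloisRepresentations

variable (L : Type) [Field L] [NumberField L] [IsCMField L] (v : HeightOneSpectrum (𝓞 ↥(maximalRealSubfield L)))
  (w : PlacesOver L v) (hw : IsCMField.complexConj L • w.1 = w.1)

set_option maxHeartbeats 400000 in
include hw in
/-- **EXACT-DEPTH COUNT OF THE `γ`-FIXED SELF-DUAL VERTICES AT `w`**: `∃ e ≤ 1, (Even (log |⟨p₀,p₀⟩|) ↔ e = 0) ∧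
#{Λ ∈ S((Φ₂)_w, γ) | depth exactly i at u₁} = [i ≤ N ∧ (N − i) % 2 = e]·w(q_v, N − i)` — the type-`e` vertices of the fixed ball at distance exactly `N − i` from the
vertex fixed by the torus (§0 through the ★ (L5-d1) frame, ★ FILE 4 package). [cite: Kottwitz1988, §2] [cite: Flicker1998UnitaryFL, §6 p. 95 REMARK] -/
theorem exists_ncard_selfDualStable_antidiagTwo_depth_eq_ite_at (hunr : Algebra.IsUnramifiedIn (𝓞 L) v.asIdeal)
    {γ P : GL (Fin 2) (w.1.adicCompletion L)} {u : Fin 2 → w.1.adicCompletion L}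
    (hγ : γ ∈ Literature.AlgebraicGeometry.ShimuraVarieties.unitaryGroup (galAdicCompletionMap (L := L) (IsCMField.complexConj L) hw)
      (placeForm (Matrix.of fun i j : Fin 2 => if i.val + j.val + 1 = 2 then (1 : L) else 0) w.1))
    (hP : (γ : Matrix (Fin 2) (Fin 2) (w.1.adicCompletion L)) * P = P * diagonal u) (hu : Function.Injective u)
    (hu1 : ∀ i, galAdicCompletionMap (L := L) (IsCMField.complexConj L) hw (u i) * u i = 1) {N : ℕ}
    (hN : valuation (w.1.adicCompletion L) (u 0 - u 1) =
      valuation (w.1.adicCompletion L) (toPlace v w (HeckeCharacter.uniformizer ↥(maximalRealSubfield L) v : v.adicCompletion ↥(maximalRealSubfield L)) ^ N))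
    (i : ℕ) :
    ∃ e : ℕ, e ≤ 1 ∧
      (Even (WithZero.log (Valued.v (twistGram (galAdicCompletionMap (L := L) (IsCMField.complexConj L) hw)
        (placeForm (Matrix.of fun i j : Fin 2 => if i.val + j.val + 1 = 2 then (1 : L) else 0) w.1) P.val 0 0))) ↔ e = 0) ∧
      {Λ : Submodule 𝒪[w.1.adicCompletion L] (Fin 2 → w.1.adicCompletion L) |
          ((∃ g : GL (Fin 2) (w.1.adicCompletion L),
            (∃ J' ∈ glInt 2 (w.1.adicCompletion L), (J' : Matrix (Fin 2) (Fin 2) (w.1.adicCompletion L)) =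
              formCongr (galAdicCompletionMap (L := L) (IsCMField.complexConj L) hw) g
                (placeForm (Matrix.of fun i j : Fin 2 => if i.val + j.val + 1 = 2 then (1 : L) else 0) w.1)) ∧
            Λ = Submodule.span 𝒪[w.1.adicCompletion L] (Set.range ((g : Matrix (Fin 2) (Fin 2) (w.1.adicCompletion L)))ᵀ)) ∧
          Λ.map ((Matrix.toLin' ((γ : GL (Fin 2) (w.1.adicCompletion L)) : Matrix (Fin 2) (Fin 2) (w.1.adicCompletion L))).restrictScalars
            𝒪[w.1.adicCompletion L]) = Λ) ∧
          (Λ.map ((Matrix.toLin' (((γ : GL (Fin 2) (w.1.adicCompletion L)) : Matrix (Fin 2) (Fin 2) (w.1.adicCompletion L)) -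
              u 1 • (1 : Matrix (Fin 2) (Fin 2) (w.1.adicCompletion L)))).restrictScalars 𝒪[w.1.adicCompletion L]) ≤
            Λ.map ((Matrix.toLin' (toPlace v w (HeckeCharacter.uniformizer ↥(maximalRealSubfield L) v : v.adicCompletion ↥(maximalRealSubfield L)) ^ i •
              (1 : Matrix (Fin 2) (Fin 2) (w.1.adicCompletion L)))).restrictScalars 𝒪[w.1.adicCompletion L]) ∧
          ¬ Λ.map ((Matrix.toLin' (((γ : GL (Fin 2) (w.1.adicCompletion L)) : Matrix (Fin 2) (Fin 2) (w.1.adicCompletion L)) -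
              u 1 • (1 : Matrix (Fin 2) (Fin 2) (w.1.adicCompletion L)))).restrictScalars 𝒪[w.1.adicCompletion L]) ≤
            Λ.map ((Matrix.toLin' (toPlace v w (HeckeCharacter.uniformizer ↥(maximalRealSubfield L) v : v.adicCompletion ↥(maximalRealSubfield L)) ^ (i + 1) •
              (1 : Matrix (Fin 2) (Fin 2) (w.1.adicCompletion L)))).restrictScalars 𝒪[w.1.adicCompletion L]))}.ncard =
      if i ≤ N ∧ (N - i) % 2 = e then (if N - i = 0 then 1 else Nat.card (𝓞 ↥(maximalRealSubfield L) ⧸ v.asIdeal) ^ (N - i - 1) * (Nat.card (𝓞 ↥(maximalRealSubfield L) ⧸ v.asIdeal) + 1)) else 0 := by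
  classical
  obtain ⟨c, D, e, hD, he1, hpar, hform⟩ :=
    exists_rescaling_formCongr_eq_uniformizer_pow_smul_one L v w hw hunr (placeForm_antidiagTwo_hermitian L v w hw)
      (det_placeForm_antidiagTwo_ne_zero_and_even L v w).1 (det_placeForm_antidiagTwo_ne_zero_and_even L v w).2 hγ hP hu hu1
  refine ⟨e, he1, hpar, ?_⟩
  obtain ⟨σO, a₀, hσO', hσσ, ha₀, hq⟩ := exists_integer_involution_of_isUnramifiedIn L v w hw hunr
  have hϖv := Liu2021.LemD1IndexedNonVacuityInertCofinite.valued_toPlace_uniformizer_of_isUnramifiedIn L v hunr w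
  have hϖ : IsUniformizingElement
      (toPlace v w (HeckeCharacter.uniformizer ↥(maximalRealSubfield L) v : v.adicCompletion ↥(maximalRealSubfield L))) :=
    isUniformizingElement_of_v_eq hϖv
  haveI : IsDiscreteValuationRing 𝒪[w.1.adicCompletion L] := isDiscreteValuationRing_integer_of_compatible hϖv
  have hσϖ := galAdicCompletionMap_toPlace_self L v w hw (HeckeCharacter.uniformizer ↥(maximalRealSubfield L) v : v.adicCompletion _)
  have hval : ∀ i, valuation (w.1.adicCompletion L) (u i) = 1 := fun i => valuation_eq_one_of_galAdicCompletionMap_mul_self L v w hw (hu1 i)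
  have hγ' := coe_inv_mul_mul_eq_of_eigenframe L v w hP hD
  rw [← zpow_natCast] at hform
  exact ncard_selfDualStable_depth_eq_ite_of_frame _ hϖ σO hσO' hσσ hσϖ he1 _ γ (P * D) hγ' (hval 0) (hval 1) hN ha₀ hq hform i

-- the `L_w`-sized statement (two level predicates, modular token) costs ≈ 2× the default elaboration budget; no search is involved
set_option maxHeartbeats 800000 in
include hw in
/-- **EXACT-DEPTH COUNT OF THE `γ`-FIXED ϖ-MODULAR VERTICES AT `w`**: `∃ e ≤ 1, (Even (log |⟨p₀,p₀⟩|) ↔ e = 1) ∧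
#{Λ ∈ M((Φ₂)_w, γ) | depth exactly i at u₁} = [i ≤ N ∧ (N − i) % 2 = e]·w(q_v, N − i)` (the other vertex type; parity flip as in ★ FILE 4).
[cite: Kottwitz1988, §2] [cite: Flicker1998UnitaryFL, §6 p. 95 REMARK] [cite: Rogawski1990, §4.9 Lemma 4.9.3 p. 56] -/
theorem exists_ncard_modularStable_antidiagTwo_depth_eq_ite_at (hunr : Algebra.IsUnramifiedIn (𝓞 L) v.asIdeal)
    {γ P : GL (Fin 2) (w.1.adicCompletion L)} {u : Fin 2 → w.1.adicCompletion L}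
    (hγ : γ ∈ Literature.AlgebraicGeometry.ShimuraVarieties.unitaryGroup (galAdicCompletionMap (L := L) (IsCMField.complexConj L) hw)
      (placeForm (Matrix.of fun i j : Fin 2 => if i.val + j.val + 1 = 2 then (1 : L) else 0) w.1))
    (hP : (γ : Matrix (Fin 2) (Fin 2) (w.1.adicCompletion L)) * P = P * diagonal u) (hu : Function.Injective u)
    (hu1 : ∀ i, galAdicCompletionMap (L := L) (IsCMField.complexConj L) hw (u i) * u i = 1) {N : ℕ}
    (hN : valuation (w.1.adicCompletion L) (u 0 - u 1) =
      valuation (w.1.adicCompletion L) (toPlace v w (HeckeCharacter.uniformizer ↥(maximalRealSubfield L) v : v.adicCompletion ↥(maximalRealSubfield L)) ^ N))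
    (i : ℕ) :
    ∃ e : ℕ, e ≤ 1 ∧
      (Even (WithZero.log (Valued.v (twistGram (galAdicCompletionMap (L := L) (IsCMField.complexConj L) hw)
        (placeForm (Matrix.of fun i j : Fin 2 => if i.val + j.val + 1 = 2 then (1 : L) else 0) w.1) P.val 0 0))) ↔ e = 1) ∧
      {Λ : Submodule 𝒪[w.1.adicCompletion L] (Fin 2 → w.1.adicCompletion L) |
          ((∃ g : GL (Fin 2) (w.1.adicCompletion L),
            (∃ J' ∈ glInt 2 (w.1.adicCompletion L),
              (toPlace v w (HeckeCharacter.uniformizer ↥(maximalRealSubfield L) v : v.adicCompletion ↥(maximalRealSubfield L))) •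
                  (J' : Matrix (Fin 2) (Fin 2) (w.1.adicCompletion L)) =
                formCongr (galAdicCompletionMap (L := L) (IsCMField.complexConj L) hw) g
                  (placeForm (Matrix.of fun i j : Fin 2 => if i.val + j.val + 1 = 2 then (1 : L) else 0) w.1)) ∧
            Λ = Submodule.span 𝒪[w.1.adicCompletion L] (Set.range ((g : Matrix (Fin 2) (Fin 2) (w.1.adicCompletion L)))ᵀ)) ∧
          Λ.map ((Matrix.toLin' ((γ : GL (Fin 2) (w.1.adicCompletion L)) : Matrix (Fin 2) (Fin 2) (w.1.adicCompletion L))).restrictScalars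
            𝒪[w.1.adicCompletion L]) = Λ) ∧
          (Λ.map ((Matrix.toLin' (((γ : GL (Fin 2) (w.1.adicCompletion L)) : Matrix (Fin 2) (Fin 2) (w.1.adicCompletion L)) -
              u 1 • (1 : Matrix (Fin 2) (Fin 2) (w.1.adicCompletion L)))).restrictScalars 𝒪[w.1.adicCompletion L]) ≤
            Λ.map ((Matrix.toLin' (toPlace v w (HeckeCharacter.uniformizer ↥(maximalRealSubfield L) v : v.adicCompletion ↥(maximalRealSubfield L)) ^ i •
              (1 : Matrix (Fin 2) (Fin 2) (w.1.adicCompletion L)))).restrictScalars 𝒪[w.1.adicCompletion L]) ∧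
          ¬ Λ.map ((Matrix.toLin' (((γ : GL (Fin 2) (w.1.adicCompletion L)) : Matrix (Fin 2) (Fin 2) (w.1.adicCompletion L)) -
              u 1 • (1 : Matrix (Fin 2) (Fin 2) (w.1.adicCompletion L)))).restrictScalars 𝒪[w.1.adicCompletion L]) ≤
            Λ.map ((Matrix.toLin' (toPlace v w (HeckeCharacter.uniformizer ↥(maximalRealSubfield L) v : v.adicCompletion ↥(maximalRealSubfield L)) ^ (i + 1) •
              (1 : Matrix (Fin 2) (Fin 2) (w.1.adicCompletion L)))).restrictScalars 𝒪[w.1.adicCompletion L]))}.ncard =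
      if i ≤ N ∧ (N - i) % 2 = e then (if N - i = 0 then 1 else Nat.card (𝓞 ↥(maximalRealSubfield L) ⧸ v.asIdeal) ^ (N - i - 1) * (Nat.card (𝓞 ↥(maximalRealSubfield L) ⧸ v.asIdeal) + 1)) else 0 := by
  classical
  have hϖ0 := toPlace_uniformizer_ne_zero L v w hunr
  obtain ⟨hJ', hJ'0, hJ'ev, hU⟩ := inv_uniformizer_smul_placeForm_antidiagTwo_package L v w hw hunr
  obtain ⟨c, D, e, hD, he1, hpar, hform⟩ :=
    exists_rescaling_formCongr_eq_uniformizer_pow_smul_one L v w hw hunr hJ' hJ'0 hJ'ev (hU γ hγ) hP hu hu1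
  refine ⟨e, he1, ?_, ?_⟩
  · -- the parity bit flips: `⟨p₀,p₀⟩_{ϖ⁻¹J} = ϖ⁻¹ ⟨p₀,p₀⟩_J`
    have hvϖinv : Valued.v (toPlace v w (HeckeCharacter.uniformizer ↥(maximalRealSubfield L) v : v.adicCompletion ↥(maximalRealSubfield L)))⁻¹ =
        WithZero.exp (1 : ℤ) := by
      rw [map_inv₀, valued_toPlace_uniformizer L v w hunr, ← WithZero.exp_neg, neg_neg]
    have htw : twistGram (galAdicCompletionMap (L := L) (IsCMField.complexConj L) hw)
        ((toPlace v w (HeckeCharacter.uniformizer ↥(maximalRealSubfield L) v : v.adicCompletion ↥(maximalRealSubfield L)))⁻¹ •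
          placeForm (Matrix.of fun i j : Fin 2 => if i.val + j.val + 1 = 2 then (1 : L) else 0) w.1) P.val 0 0 =
        (toPlace v w (HeckeCharacter.uniformizer ↥(maximalRealSubfield L) v : v.adicCompletion ↥(maximalRealSubfield L)))⁻¹ *
          twistGram (galAdicCompletionMap (L := L) (IsCMField.complexConj L) hw)
            (placeForm (Matrix.of fun i j : Fin 2 => if i.val + j.val + 1 = 2 then (1 : L) else 0) w.1) P.val 0 0 := by
      simp only [twistGram_def, Matrix.mul_smul, Matrix.smul_mul, Matrix.smul_apply, smul_eq_mul]
    have hx0 := twistGram_eigenframe_apply_ne_zero (galAdicCompletionMap (L := L) (IsCMField.complexConj L) hw) _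
      (det_placeForm_antidiagTwo_ne_zero_and_even L v w).1 hγ hP hu hu1 0
    rw [htw, map_mul, WithZero.log_mul ((Valuation.ne_zero_iff _).2 (inv_ne_zero hϖ0)) ((Valuation.ne_zero_iff _).2 hx0), hvϖinv, WithZero.log_exp,
      add_comm, Int.even_add_one] at hpar
    rcases Nat.le_one_iff_eq_zero_or_eq_one.1 he1 with rfl | rfl
    · exact ⟨fun h => ((hpar.2 rfl) h).elim, fun h => absurd h zero_ne_one⟩
    · exact ⟨fun _ => rfl, fun _ => not_not.1 fun hn => absurd (hpar.1 hn) one_ne_zero⟩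
  obtain ⟨σO, a₀, hσO', hσσ, ha₀, hq⟩ := exists_integer_involution_of_isUnramifiedIn L v w hw hunr
  have hϖv := Liu2021.LemD1IndexedNonVacuityInertCofinite.valued_toPlace_uniformizer_of_isUnramifiedIn L v hunr w
  have hϖ : IsUniformizingElement
      (toPlace v w (HeckeCharacter.uniformizer ↥(maximalRealSubfield L) v : v.adicCompletion ↥(maximalRealSubfield L))) :=
    isUniformizingElement_of_v_eq hϖv
  haveI : IsDiscreteValuationRing 𝒪[w.1.adicCompletion L] := isDiscreteValuationRing_integer_of_compatible hϖv
  have hσϖ := galAdicCompletionMap_toPlace_self L v w hw (HeckeCharacter.uniformizer ↥(maximalRealSubfield L) v : v.adicCompletion _)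
  have hval : ∀ i, valuation (w.1.adicCompletion L) (u i) = 1 := fun i => valuation_eq_one_of_galAdicCompletionMap_mul_self L v w hw (hu1 i)
  have hγ' := coe_inv_mul_mul_eq_of_eigenframe L v w hP hD
  rw [← zpow_natCast] at hform
  exact ncard_modularStable_depth_eq_ite_of_frame _ hϖ σO hσO' hσσ hσϖ he1 _ γ (P * D) hγ' (hval 0) (hval 1) hN ha₀ hq hform i

end Literature.NumberTheory.Automorphic.UnitaryGroup

end
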